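import Summits.NavierStokesRegularity.NavierStokesRegularity.Theorems.AdaptedFrequencyAdaptedFrequencyConvergesOfMildHullRigidity
import Summits.NavierStokesRegularity.NavierStokesRegularity.Theorems.SymmetryModuliCountLiouvilleKillsTypeI
import Summits.NavierStokesRegularity.NavierStokesRegularity.Theses.TypeILiouville
import Literature.Analysis.FluidPDE.TypeIAncientMild
import Literature.Analysis.FluidPDE.VorticityCalculus
import Literature.Analysis.FluidPDE.ClassicalSolutionCalculus
import HarnessLib

/-!
# Crux `AdaptedFrequencyConverges` (stmt-NavierStokesRegularity-10493), line `cloud-frame-effective-tsai`: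
  where the crux sits — certificates against EXISTING items

Helper file (`--supports` the crux item; lead prover-line-stmt-NavierStokesRegularity-10493-a1-0,
skeleton v3 of the line). Three line leads reduced the crux, sorry-free, to ONE registered stub
`stub_pinchedMildHullHStationary` — h-stationarity of PINCHED unit-viscosity Type-I ancient MILD pairs
carrying a (unique) Gaussian-comparable adapted kernel (the hypothesis of the landed
`adaptedFrequencyConverges_of_pinchedMildHullHStationary`, `…OfMildHullRigidity.lean`). This file
records, kernel-checked, how that stub and the crux relate to statements that ALREADY EXIST on the
ledger:

* `pinchedMildHull_false_of_liouville` — under the Liouville statement (L') for the KNSS/Oseen class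
  `IsTypeIAncientMild` ("every unit-viscosity Type-I ancient mild field vanishes") the pinched mild hull
  is EMPTY (a zero field has zero adapted enstrophy, contradicting the floor `0 < c ≤ (−τ)² H̄`);
  hence `pinchedMildHullHStationary_of_liouville` (the registered stub, vacuously) and
* `adaptedFrequencyConverges_of_typeIAncientLiouville` —
  **`Theses.SymmetryModuliCount.TypeIAncientLiouville` (stmt-NavierStokesRegularity-4050) ⟹ the crux**;
* `liouville_isTypeIAncientMild_of_liouvilleL` — (L) (KNSS Liouville conjecture, the route item
  `Theses.TypeILiouville.TypeIliouvilleL` = stmt-NavierStokesRegularity-10661, definiens of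
  `LiouvilleConjectureNS`) ⟹ (L') on `IsTypeIAncientMild` (time shift into the bounded class,
  continuity of slices, `IsTypeIAncientMild.eq_zero_of_slice_const`); hence
  `adaptedFrequencyConverges_of_liouvilleL` — **(L) ⟹ the crux**;
* `adaptedFrequencyConverges_of_noTypeIBlowup` — **the route's own target `NoTypeIBlowup` ⟹ the crux**
  (vacuity: a classical continuation past `T` is bounded on the small backward cylinders at `(T, x₀)`,
  so `(T, x₀)` is not backward-singular); with the proved `TypeIGlue` this says: modulo
  `FrequencyRigidity` and the proved supports, the crux is EQUIVALENT to the target;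
* `adaptedFrequencyConverges_of_typeIAncientLiouville'` — the same implication as the second bullet
  by the other road: `symmetryModuliCount_liouvilleKillsTypeI_proof` (PROVED, stmt-4056) gives
  `TypeIAncientLiouville → NoTypeIBlowup`, then vacuity.

Nothing here is new mathematics; these are the dependency edges the planners asked for ("re-line the
crux as a Liouville theorem about the KNSS class"), made formal so that the crux can be parked on
stmt-4050 / stmt-10661 by name.
-/

noncomputable section

namespace Summit.NavierStokesRegularity.NavierStokesRegularity.Theorems.AdaptedFrequencyConverges.CloudFrameEffectiveTsai

open scoped Topology ENNReal
open Literature.Analysis Literature.Analysis.FluidPDE Set Filter MeasureTheory Function Metric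
open Summit.NavierStokesRegularity.NavierStokesRegularity.Theses

/-! ## (L') empties the pinched mild hull -/

/-- **Under the Liouville statement (L') for `IsTypeIAncientMild`, the pinched mild hull is empty.**
If every unit-viscosity Type-I ancient mild field vanishes on `t < 0`, then no such field `W` can
carry a weight `K` with `0 < c ≤ (−τ)² · adaptedEnstrophy W K τ` for all `τ < 0`: at `τ = −1` the
slice `W(−1)` is the zero field, whose curl and hence adapted enstrophy vanish. [folklore] -/
theorem pinchedMildHull_false_of_liouville
    (hL : ∀ (C : ℝ) (W : ℝ → EuclideanSpace ℝ (Fin 3) → EuclideanSpace ℝ (Fin 3)),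
      IsTypeIAncientMild C W → ∀ t < 0, ∀ x, W t x = 0)
    {C₀ c C' : ℝ} {W : ℝ → EuclideanSpace ℝ (Fin 3) → EuclideanSpace ℝ (Fin 3)}
    {K : ℝ → EuclideanSpace ℝ (Fin 3) → ℝ} (hc : 0 < c) (hW : IsTypeIAncientMild C₀ W)
    (hpin : ∀ τ ∈ Iio (0:ℝ), c ≤ (-τ) ^ 2 * adaptedEnstrophy W K τ ∧
      (-τ) ^ 2 * adaptedEnstrophy W K τ ≤ C') :
    False := by
  have hW0 : W (-1) = (0 : EuclideanSpace ℝ (Fin 3) → EuclideanSpace ℝ (Fin 3)) :=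
    funext fun x => hL C₀ W hW (-1) (by norm_num) x
  have hH : adaptedEnstrophy W K (-1) = 0 := by
    rw [adaptedEnstrophy_apply, hW0]
    simp
  have h1 := (hpin (-1) (by norm_num)).1
  rw [hH, mul_zero] at h1
  exact lt_irrefl _ (hc.trans_le h1)

/-- **The registered stub `stub_pinchedMildHullHStationary` of line `cloud-frame-effective-tsai`
(skeleton v3) follows from (L') for `IsTypeIAncientMild`** — vacuously, the pinched mild hull being
empty (`pinchedMildHull_false_of_liouville`). The statement proved is the stub's registered signature
with (L') prepended. [folklore] -/
theorem pinchedMildHullHStationary_of_liouville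
    (hL : ∀ (C : ℝ) (W : ℝ → EuclideanSpace ℝ (Fin 3) → EuclideanSpace ℝ (Fin 3)),
      IsTypeIAncientMild C W → ∀ t < 0, ∀ x, W t x = 0) :
    ∀ (C₀ c C' : ℝ) (W : ℝ → (EuclideanSpace ℝ (Fin 3)) → (EuclideanSpace ℝ (Fin 3))) (K : ℝ → (EuclideanSpace ℝ (Fin 3)) → ℝ), 0 ≤ C₀ → 0 < c → IsTypeIAncientMild C₀ W → IsAdaptedBackwardKernel 1 W (Iio 0) 0 0 K → IsGaussianComparable K (Iio 0) 0 0 → (∀ K' : ℝ → (EuclideanSpace ℝ (Fin 3)) → ℝ, IsAdaptedBackwardKernel 1 W (Iio 0) 0 0 K' → IsGaussianComparable K' (Iio 0) 0 0 → ∀ t ∈ Iio (0:ℝ), K' t = K t) → (∀ τ ∈ Iio (0:ℝ), c ≤ (-τ) ^ 2 * adaptedEnstrophy W K τ ∧ (-τ) ^ 2 * adaptedEnstrophy W K τ ≤ C') → ∀ τ₁ τ₂ : ℝ, τ₁ < 0 → τ₂ < 0 → (-τ₁) ^ 2 * adaptedEnstrophy W K τ₁ = (-τ₂) ^ 2 *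 adaptedEnstrophy W K τ₂ := by
  intro C₀ c C' W K _ hc hW _ _ _ hpin τ₁ τ₂ _ _
  exact (pinchedMildHull_false_of_liouville hL hc hW hpin).elim

/-! ## stmt-4050 `TypeIAncientLiouville` ⟹ the crux -/

/-- The route item `Theses.SymmetryModuliCount.TypeIAncientLiouville` (stmt-NavierStokesRegularity-4050,
(L') in the KNSS gauge, stated with the Oseen kernel written out) is exactly the Liouville statement for
the tree's class `IsTypeIAncientMild` (`isTypeIAncientMild_iff`). [folklore] -/
theorem liouville_isTypeIAncientMild_of_typeIAncientLiouville
    (h : SymmetryModuliCount.TypeIAncientLiouville) :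
    ∀ (C : ℝ) (W : ℝ → EuclideanSpace ℝ (Fin 3) → EuclideanSpace ℝ (Fin 3)),
      IsTypeIAncientMild C W → ∀ t < 0, ∀ x, W t x = 0 :=
  fun C W hW => h C W (isTypeIAncientMild_iff.1 hW)

/-- **stmt-NavierStokesRegularity-4050 ⟹ stmt-NavierStokesRegularity-10493.** The target
`TypeIAncientLiouville` of route SymmetryModuliCount implies the crux `AdaptedFrequencyConverges` of
route AdaptedFrequency: the landed sharpened hull reduction
`adaptedFrequencyConverges_of_pinchedMildHullHStationary` fed with the (vacuous) h-stationarity of the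
empty pinched mild hull. [folklore] -/
theorem adaptedFrequencyConverges_of_typeIAncientLiouville :
    Summit.NavierStokesRegularity.NavierStokesRegularity.Theses.SymmetryModuliCount.TypeIAncientLiouville → Summit.NavierStokesRegularity.NavierStokesRegularity.Theses.AdaptedFrequency.AdaptedFrequencyConverges :=
  fun h => adaptedFrequencyConverges_of_pinchedMildHullHStationary
    (pinchedMildHullHStationary_of_liouville (liouville_isTypeIAncientMild_of_typeIAncientLiouville h))

/-! ## (L) ⟹ (L') on `IsTypeIAncientMild` ⟹ the crux -/

/-- **(L) implies (L') on the Type-I ancient mild class.** Assume the KNSS Liouville conjecture in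
the tree's form (the definiens of `LiouvilleConjectureNS` = route item `TypeILiouville.TypeIliouvilleL`,
stmt-NavierStokesRegularity-10661): every bounded ancient mild solution (`ν = 1`) with a.e.-strongly
measurable slices is a.e. constant on every slice. Then every `W ∈ IsTypeIAncientMild C` vanishes on
`t < 0`: for `t < 0` the time shift `s ↦ W(s − δ)`, `δ = −t/2`, is a bounded ancient mild solution
with continuous (hence measurable) slices (`IsTypeIAncientMild.isBoundedAncientMildSolution_sub`,
`.comp_sub_right`), so `W t` is a.e. — and by continuity everywhere — constant; a slice-constant
element of the gauge is zero (`IsTypeIAncientMild.eq_zero_of_slice_const`: KNSS 2009 Rem. 6.1 and the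
Type-I decay at `−∞`). [cite: KochNadirashviliSereginSverak2009, §1 p. 3 and Remark 6.1 (arXiv:0709.3599)] -/
theorem liouville_isTypeIAncientMild_of_liouvilleL
    (hL : ∀ u : ℝ → EuclideanSpace ℝ (Fin 3) → EuclideanSpace ℝ (Fin 3),
      FluidPDE.IsBoundedAncientMildSolution 1 u →
        (∀ t < 0, AEStronglyMeasurable (u t) volume) →
          ∀ t < 0, ∃ b : EuclideanSpace ℝ (Fin 3), u t =ᵐ[volume] fun _ => b) :
    ∀ (C : ℝ) (W : ℝ → EuclideanSpace ℝ (Fin 3) → EuclideanSpace ℝ (Fin 3)),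
      IsTypeIAncientMild C W → ∀ t < 0, ∀ x, W t x = 0 := by
  intro C W hW
  -- every slice is spatially constant
  have hconst : ∀ t < 0, ∀ x, W t x = W t 0 := by
    intro t ht x
    set δ : ℝ := -t / 2 with hδ
    have hδ0 : 0 < δ := by rw [hδ]; linarith
    have hB : FluidPDE.IsBoundedAncientMildSolution 1 (fun s => W (s - δ)) :=
      hW.isBoundedAncientMildSolution_sub hδ0
    have hmeas : ∀ s < 0, AEStronglyMeasurable ((fun s => W (s - δ)) s) volume :=
      fun s hs => (hW.comp_sub_right hδ0.le).aestronglyMeasurable_slice hs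
    obtain ⟨b, hb⟩ := hL _ hB hmeas (t + δ) (by rw [hδ]; linarith)
    have hb' : W t =ᵐ[volume] fun _ => b := by
      simpa only [add_sub_cancel_right] using hb
    have heq : W t = fun _ => b :=
      (Continuous.ae_eq_iff_eq volume (hW.continuous_slice ht) continuous_const).1 hb'
    have hx : W t x = b := by rw [heq]
    have h0 : W t 0 = b := by rw [heq]
    rw [hx, h0]
  intro t ht x
  exact hW.eq_zero_of_slice_const (b := fun s => W s 0) hconst ht x

/-- **stmt-NavierStokesRegularity-10661 (L) ⟹ stmt-NavierStokesRegularity-10493.** The KNSS Liouville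
conjecture, as the route item `Theses.TypeILiouville.TypeIliouvilleL` (= the definiens of
`LiouvilleConjectureNS`, stmt-0057), implies the crux `AdaptedFrequencyConverges`
(`liouville_isTypeIAncientMild_of_liouvilleL` + the hull reduction). [folklore] -/
theorem adaptedFrequencyConverges_of_liouvilleL :
    Summit.NavierStokesRegularity.NavierStokesRegularity.Theses.TypeILiouville.TypeIliouvilleL → Summit.NavierStokesRegularity.NavierStokesRegularity.Theses.AdaptedFrequency.AdaptedFrequencyConverges :=
  fun hL => adaptedFrequencyConverges_of_pinchedMildHullHStationary
    (pinchedMildHullHStationary_of_liouville (liouville_isTypeIAncientMild_of_liouvilleL hL))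

/-! ## The route's own target ⟹ the crux (vacuity) -/

/-- **A classical continuation past `T` is essentially bounded on the small backward cylinders at
`(T, x₀)`.** If `(u', p')` is classical on `[0, T')`, `T < T'`, agrees with `u` on `[0, T)`, and
`0 < r`, `r² < T`, then `‖u‖_{L^∞(Q_r(T, x₀))} < ∞`: on `Q_r(T, x₀) = (T − r², T) × B_r(x₀)` the field
`u` coincides with `u'`, which is continuous on the compact box `[T − r², T] × B̄_r(x₀) ⊂ [0, T') × ℝ³`.
[folklore] -/
theorem eLpNorm_top_parabolicCylinder_lt_top_of_extension {ν T T' : ℝ} (hTT' : T < T')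
    {u u' : ℝ → EuclideanSpace ℝ (Fin 3) → EuclideanSpace ℝ (Fin 3)}
    {p' : ℝ → EuclideanSpace ℝ (Fin 3) → ℝ} (hcl' : IsClassicalNSSolutionOn (Ico 0 T') ν 0 u' p')
    (hagree : ∀ t ∈ Ico 0 T, u' t = u t) (x₀ : EuclideanSpace ℝ (Fin 3)) {r : ℝ}
    (hrT : r ^ 2 < T) :
    eLpNorm (uncurry u) ∞ (volume.restrict (parabolicCylinder r (T, x₀))) < ∞ := by
  -- the compact box and a bound for `u'` on it
  set Kb : Set (ℝ × EuclideanSpace ℝ (Fin 3)) := Icc (T - r ^ 2) T ×ˢ closedBall x₀ r with hKb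
  have hKc : IsCompact Kb := isCompact_Icc.prod (isCompact_closedBall x₀ r)
  have hr0 : 0 < T - r ^ 2 := sub_pos.2 hrT
  have hKsub : Kb ⊆ Ico 0 T' ×ˢ (univ : Set (EuclideanSpace ℝ (Fin 3))) :=
    prod_mono (fun t ht => ⟨hr0.le.trans ht.1, ht.2.trans_lt hTT'⟩) (subset_univ _)
  have hcont : ContinuousOn (uncurry u') Kb := hcl'.smooth_velocity.continuousOn.mono hKsub
  obtain ⟨R, hR⟩ := hKc.exists_bound_of_continuousOn hcont
  -- `u = u'` on the cylinder, pointwise bound there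
  have hQK : parabolicCylinder r (T, x₀) ⊆ Kb := by
    intro z hz
    rw [mem_parabolicCylinder] at hz
    exact ⟨⟨hz.1.1.le, hz.1.2.le⟩, mem_closedBall.2 hz.2.le⟩
  have hbound : ∀ z ∈ parabolicCylinder r (T, x₀), ‖uncurry u z‖ ≤ R := by
    intro z hz
    have hz' := hz
    rw [mem_parabolicCylinder] at hz'
    have ht : z.1 ∈ Ico 0 T := ⟨(hr0.trans hz'.1.1).le, hz'.1.2⟩
    have e : uncurry u z = uncurry u' z := by
      simp only [uncurry]
      rw [hagree z.1 ht]
    rw [e]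
    exact hR z (hQK hz)
  have hae : ∀ᵐ z ∂(volume.restrict (parabolicCylinder r (T, x₀))), ‖uncurry u z‖ ≤ R :=
    ae_restrict_of_forall_mem (isOpen_parabolicCylinder r (T, x₀)).measurableSet hbound
  rw [eLpNorm_exponent_top]
  exact eLpNormEssSup_lt_top_of_ae_bound hae

/-- **A solution that extends smoothly past `T` has no backward-singular point at time `T`**: for
`0 < T` and `HasSmoothExtensionPast ν 0 u T`, at every `x₀` some backward cylinder `Q_r(T, x₀)`,
`r > 0`, carries a finite `L^∞` norm of `u` (take `r² < T`). Stated as the negation of the inlined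
backward-singularity clause of the route's items. [folklore] -/
theorem not_backwardSingular_of_hasSmoothExtensionPast {ν T : ℝ} (hT : 0 < T)
    {u : ℝ → EuclideanSpace ℝ (Fin 3) → EuclideanSpace ℝ (Fin 3)}
    (hext : HasSmoothExtensionPast ν 0 u T) (x₀ : EuclideanSpace ℝ (Fin 3)) :
    ¬ ∀ r : ℝ, 0 < r →
      eLpNorm (uncurry u) ⊤ (volume.restrict (parabolicCylinder r (T, x₀))) = ⊤ := by
  intro hsing
  obtain ⟨T', hT', u', p', hcl', hagree⟩ := hext
  -- a small radius: `r = √T / 2`, `r² = T/4 < T`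
  set r : ℝ := Real.sqrt T / 2 with hr
  have hr0 : 0 < r := by rw [hr]; positivity
  have hrT : r ^ 2 < T := by
    rw [hr, div_pow, Real.sq_sqrt hT.le]
    linarith
  have hlt := eLpNorm_top_parabolicCylinder_lt_top_of_extension hT' hcl' hagree x₀ hrT
  rw [hsing r hr0] at hlt
  exact lt_irrefl _ hlt

/-- **The route's target implies the crux (vacuity).** `NoTypeIBlowup → AdaptedFrequencyConverges`:
under `NoTypeIBlowup` a Type-I Leray–Hopf classical solution from a rapidly decaying datum extends past
`T`, so `(T, x₀)` cannot be backward-singular (`not_backwardSingular_of_hasSmoothExtensionPast`), and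
the crux's hypotheses are contradictory. Together with the proved `TypeIGlue`
(`AdaptedFrequencyConverges → FrequencyRigidity → TangentFlowTransfer → AdaptedKernelExists →
SingularPointExists → NoTypeIBlowup`, the last three items proved), the crux is EQUIVALENT to the
target modulo `FrequencyRigidity`. [folklore] -/
theorem adaptedFrequencyConverges_of_noTypeIBlowup :
    Summit.NavierStokesRegularity.NavierStokesRegularity.Theses.AdaptedFrequency.NoTypeIBlowup → Summit.NavierStokesRegularity.NavierStokesRegularity.Theses.AdaptedFrequency.AdaptedFrequencyConverges := by
  intro h ν T hν hT u p hcl hLH hdec hTI x₀ t₀ G _ hsing _ _ H Λ _ _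
  exact (not_backwardSingular_of_hasSmoothExtensionPast hT (h ν T hν hT u p hcl hLH hdec hTI) x₀
    hsing).elim

/-- **stmt-4050 ⟹ the crux, second road**: `TypeIAncientLiouville → NoTypeIBlowup` is the PROVED
support `LiouvilleKillsTypeI` of route SymmetryModuliCount
(`symmetryModuliCount_liouvilleKillsTypeI_proof`, stmt-4056; KNSS 2009 §6), and the target implies the
crux by vacuity (`adaptedFrequencyConverges_of_noTypeIBlowup`). [folklore] -/
theorem adaptedFrequencyConverges_of_typeIAncientLiouville' :
    SymmetryModuliCount.TypeIAncientLiouville → AdaptedFrequency.AdaptedFrequencyConverges :=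
  fun h => adaptedFrequencyConverges_of_noTypeIBlowup
    (Summit.NavierStokesRegularity.NavierStokesRegularity.Theorems.symmetryModuliCount_liouvilleKillsTypeI_proof h)

end Summit.NavierStokesRegularity.NavierStokesRegularity.Theorems.AdaptedFrequencyConverges.CloudFrameEffectiveTsai

end
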